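import Summits.AtomisticToContinuum.Crystallization.Theorems.ChargedEnergyGapChartRows
import Summits.AtomisticToContinuum.Crystallization.Theorems.ChargedEnergyGapCellChecker
import HarnessLib

/-!
# ChargedEnergyGap · NODE 109B «EmptyCell» — the ℚ-reflected EMPTY census cell (door D2d of memo CELLCHECKER-SPEC-g92 §6)

decomp-a2c lens-3 g92 (imports NODE 109A «ChartRows» for the criterion and NODE 108C «CellChecker» for the rational slot kit `castW`,
`allSlots`, `qle/qlt`).

The second census primitive next to the cost cell of NODES 107/108: a depth box `lo ≤ dt ∘ holeVertex 0 ≤ hi` (six slots) over a frame-scale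
slab `rho0 ≤ ρ ≤ rho1` that contains NO chart-realisable tuple, certified by the closed-form criterion `boxEmpty_of_vertexRow` — one row owner
`e`, six non-negative multipliers `alpha`, one norm bound `n`; all rational.  `EmptyCellCert.check : EmptyCellCert → Bool` is pure ℚ arithmetic
(`decide +kernel` in census batches, exactly like `CostCellCert.check`), and ★★★ `EmptyCellCert.sound` turns `check = true` into
`¬ IsChartRealisable ρ dt` on the box × slab, with the box hypothesis in the SAME shape as `CostCellCert.sound` so that a cover can dispatch
cost cells and empty cells uniformly.  Desk emitter `num/empty92.py` (exponentiated-subgradient search for `alpha`, exact verification).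
No analysis; no placeholders.

[SPLIT beneath (T¹ᶜ) · Level-F census primitive (EMPTY cells beyond the admissibility envelope) · UNDECIDED(test = (D¹)) unchanged.] -/

noncomputable section
open scoped Classical
open Literature.MathematicalPhysics.StatisticalMechanics Literature.Geometry.DiscreteGeometry
open Summit.AtomisticToContinuum.Crystallization.Theses.PricedLinkCensus
open Summit.AtomisticToContinuum.Crystallization.Theorems.ChargedEnergyGapNegative

namespace Summit.AtomisticToContinuum.Crystallization.Theorems.ChargedEnergyGapChartDial

/-! ## §109B.1 Explicit finite sums (kernel-friendly) -/

/-- Sum over the three coordinates, spelled out. -/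
def sum3 (f : Fin 3 → ℚ) : ℚ := f 0 + f 1 + f 2

/-- Sum over the six slots, spelled out. -/
def sum6 (f : Fin 3 × Bool → ℚ) : ℚ :=
  f (0, true) + f (0, false) + f (1, true) + f (1, false) + f (2, true) + f (2, false)

/-- [formal bookkeeping] `sum3` is the `Finset` sum. -/
theorem sum3_eq (f : Fin 3 → ℚ) : sum3 f = ∑ k, f k := by
  rw [Fin.sum_univ_three, sum3]

/-- [formal bookkeeping] `sum6` is the `Finset` sum. -/
theorem sum6_eq (f : Fin 3 × Bool → ℚ) : sum6 f = ∑ e, f e := by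
  rw [Fintype.sum_prod_type, Fin.sum_univ_three, Fintype.sum_bool, Fintype.sum_bool, Fintype.sum_bool, sum6]
  ring

/-- The integer edge coordinate `(holeVertex 0 e')ₖ − (holeVertex 0 e)ₖ` of the row owner `e` against `e'`. -/
def slotDiff (e e' : Fin 3 × Bool) (k : Fin 3) : ℤ := (holeVertex 0 e') k - (holeVertex 0 e) k

/-! ## §109B.2 The certificate, the checker, the soundness theorem -/

/-- ★ EMPTY-CELL CERTIFICATE (all rational): slab `rho0 ≤ ρ ≤ rho1`, box `lo ≤ dt ∘ holeVertex 0 ≤ hi`, row owner `e`, multipliers `alpha`,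
norm bound `n`. -/
structure EmptyCellCert where
  /-- frame-scale slab -/
  rho0 : ℚ
  /-- frame-scale slab -/
  rho1 : ℚ
  /-- lower box corner (six slots) -/
  lo : Fin 3 × Bool → ℚ
  /-- upper box corner (six slots) -/
  hi : Fin 3 × Bool → ℚ
  /-- the row owner `p = holeVertex 0 e` -/
  e : Fin 3 × Bool
  /-- multipliers of the rows of `p` against the six vertices -/
  alpha : Fin 3 × Bool → ℚ
  /-- norm bound: `Σₖ (Σ_{e'} alpha e' · slotDiff e e' k)² ≤ n²` -/
  n : ℚ

/-- Squared norm of the aggregated integer edge vector `Σ_{e'} alpha e' (v_{e'} − v_e)`. -/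
def EmptyCellCert.msq (c : EmptyCellCert) : ℚ :=
  sum3 fun k => (sum6 fun e' => c.alpha e' * (slotDiff c.e e' k : ℚ)) ^ 2

/-- The criterion value `V = rho1²·Σ alpha G + (Σ alpha)·(hi e)² − Σ alpha·lo² + 2·(hi e)·rho1·n`. -/
def EmptyCellCert.V (c : EmptyCellCert) : ℚ :=
  c.rho1 ^ 2 * (sum6 fun e' => c.alpha e' * sum3 fun k => (slotDiff c.e e' k : ℚ) ^ 2)
    + (sum6 c.alpha) * c.hi c.e ^ 2 - (sum6 fun e' => c.alpha e' * c.lo e' ^ 2) + 2 * c.hi c.e * c.rho1 * c.n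

/-- ★★ THE CHECKER (pure ℚ, `decide`-able): signs, the norm bound, and `V < 0`. -/
def EmptyCellCert.check (c : EmptyCellCert) : Bool :=
  decide (0 ≤ c.rho0) && decide (c.rho0 ≤ c.rho1) && allSlots (fun q => decide (0 ≤ c.alpha q))
    && allSlots (fun q => decide (0 ≤ c.lo q)) && decide (0 ≤ c.n) && decide (c.msq ≤ c.n ^ 2) && decide (c.V < 0)

/-- ★★★ **SOUNDNESS OF THE EMPTY CELL**: a certificate that checks proves that its box × slab contains no chart-realisable tuple. -/
theorem EmptyCellCert.sound (c : EmptyCellCert) (h : c.check = true) :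
    ∀ ρ : ℝ, (c.rho0 : ℝ) ≤ ρ → ρ ≤ c.rho1 → ∀ dt : (Fin 3 → ℤ) → ℝ,
      (∀ q, castW c.lo q ≤ dt (holeVertex 0 q) ∧ dt (holeVertex 0 q) ≤ castW c.hi q) → ¬ IsChartRealisable ρ dt := by
  intro ρ hρ0 hρ1 dt hbox
  simp only [EmptyCellCert.check, Bool.and_eq_true, decide_eq_true_eq, allSlots_iff] at h
  obtain ⟨⟨⟨⟨⟨⟨h0, -⟩, hα⟩, hlo⟩, hn0⟩, hmsq⟩, hV⟩ := h
  have hρ0' : (0 : ℝ) ≤ ρ := le_trans (by exact_mod_cast h0) hρ0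
  refine boxEmpty_of_vertexRow (lo := castW c.lo) (hi := castW c.hi) c.e (fun e' => (c.alpha e' : ℝ))
    (fun e' => by exact_mod_cast hα e') (n := (c.n : ℝ)) (by exact_mod_cast hn0) ?_ hρ0' hρ1
    (fun q => by exact_mod_cast hlo q) hbox ?_
  · have h1 : (c.msq : ℝ) ≤ (c.n : ℝ) ^ 2 := by exact_mod_cast hmsq
    have h2 : (c.msq : ℝ) = ∑ k, (∑ e', (c.alpha e' : ℝ) * ((slotDiff c.e e' k : ℤ) : ℝ)) ^ 2 := by
      unfold EmptyCellCert.msq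
      rw [sum3_eq]
      simp_rw [sum6_eq]
      push_cast
      rfl
    rw [h2] at h1
    exact h1
  · have h1 : ((c.V : ℚ) : ℝ) < 0 := by exact_mod_cast hV
    have h2 : ((c.V : ℚ) : ℝ) = (c.rho1 : ℝ) ^ 2 * (∑ e', (c.alpha e' : ℝ) * ∑ k, ((slotDiff c.e e' k : ℤ) : ℝ) ^ 2)
        + (∑ e', (c.alpha e' : ℝ)) * castW c.hi c.e ^ 2 - (∑ e', (c.alpha e' : ℝ) * castW c.lo e' ^ 2)
        + 2 * castW c.hi c.e * c.rho1 * c.n := by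
      unfold EmptyCellCert.V
      simp_rw [sum6_eq, sum3_eq]
      push_cast
      rfl
    rw [h2] at h1
    exact h1

/-- ★ Batch form (census files: `theorem empties_ok : cs.all EmptyCellCert.check = true := by decide +kernel`). -/
theorem EmptyCellCert.sound_of_all {cs : List EmptyCellCert} (h : cs.all EmptyCellCert.check = true) {c : EmptyCellCert}
    (hc : c ∈ cs) :
    ∀ ρ : ℝ, (c.rho0 : ℝ) ≤ ρ → ρ ≤ c.rho1 → ∀ dt : (Fin 3 → ℤ) → ℝ,
      (∀ q, castW c.lo q ≤ dt (holeVertex 0 q) ∧ dt (holeVertex 0 q) ≤ castW c.hi q) → ¬ IsChartRealisable ρ dt :=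
  c.sound (List.all_eq_true.mp h c hc)

/-- ★ The census reading: on an empty cell the (T¹ᶜ) integrand inequality holds VACUOUSLY (the realisability binder is contradicted), in the same
shape as `CostCellCert.sound` plus the realisability hypothesis — so a cover may dispatch each cell to either checker. -/
theorem EmptyCellCert.law (c : EmptyCellCert) (h : c.check = true) {ϱ τ unit : ℝ} :
    ∀ ρ : ℝ, (c.rho0 : ℝ) ≤ ρ → ρ ≤ c.rho1 → ∀ dt : (Fin 3 → ℤ) → ℝ,
      (∀ q, castW c.lo q ≤ dt (holeVertex 0 q) ∧ dt (holeVertex 0 q) ≤ castW c.hi q) → IsChartRealisable ρ dt →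
      feetHoleCost ϱ τ ρ dt 0 ≤ domCapK unit ϱ τ ρ (chargeDepth ρ dt 0) :=
  fun ρ h0 h1 dt hbox hreal => absurd hreal (c.sound h ρ h0 h1 dt hbox)

end Summit.AtomisticToContinuum.Crystallization.Theorems.ChargedEnergyGapChartDial
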